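import Literature.MathematicalPhysics.KineticTheory.LambertianRedrawNondegenerate
import Literature.MathematicalPhysics.KineticTheory.HardSphereEulerProofs
import Summits.AtomisticToContinuum.HydrodynamicLimit.Theorems.JParityClosureOddContactSymmetryGibbsInvariance
import HarnessLib

/-!
# `Λ`-invariance of the canonical hard-sphere Gibbs laws from Liouville ⊗ noise invariance

Helper file (`--supports`) for the crux `LambertianContactSwap.LambertianEuler`
(`AtomisticToContinuum/HydrodynamicLimit`, stmt-AtomisticToContinuum-11854), line `Sketch`, stub
`stub_gibbsInvariance : LiouvilleInvarianceLambda → GibbsInvarianceLambda`.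

The local Gibbs law with CONSTANT profiles `a, u, θ` is
`localGibbsLaw σ a u θ N Φ = (liouville G (N+1) ε).withDensity F`, `ε = hsDiameter σ N`,
`F = ofReal ∘ canonicalDensity G ε (N+1) (localGibbsProfile a u θ)` and
`canonicalDensity … z = Z⁻¹ · 1_D(z) · ∏ᵢ a (2πθ)^{-3/2} exp(−‖vᵢ − u‖²/(2θ))`, a function of
`1_D(z)`, the kinetic energy `E(z)` and the total momentum `P(z)` (closed form
`tensorPow_localGibbsProfile_const` and `sum_norm_vel_sub_sq_eq`,
`Σᵢ ‖vᵢ − u‖² = 2E − 2⟪P, u⟫ + (N+1)‖u‖²`, both from the rung-0 file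
`JParityClosureOddContactSymmetryGibbsInvariance`, which proves the same invariance for the
DETERMINISTIC hard-sphere flows).
Along the Lambertian flow `Λ_t(z, ξs) = lambertFlow G ε ξs z t` the momentum is conserved
exactly (`configMomentum_lambertFlow`), the energy for every `z` and `lambertNoise`-a.e. `ξs`
(`ae_lambertNoise_forall_configEnergy_lambertFlow_torus`), and — granted the Liouville ⊗ noise
invariance `(liouville ⊗ γ^ℕ) ∘ Λ_t⁻¹ = liouville` (the hypothesis) — `Λ_t(z, ξs) ∈ D` for
`liouville ⊗ γ^ℕ`-a.e. `(z, ξs)` (`liouville (Dᶜ) = 0`).  Hence `F ∘ Λ_t = F ∘ fst` a.e., and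
`((L·F) ⊗ γ^ℕ) ∘ Λ_t⁻¹ = ((L ⊗ γ^ℕ)·(F ∘ fst)) ∘ Λ_t⁻¹ = ((L ⊗ γ^ℕ)·(F ∘ Λ_t)) ∘ Λ_t⁻¹
 = ((L ⊗ γ^ℕ) ∘ Λ_t⁻¹)·F = L·F` (`prod_withDensity_left`, `withDensity_congr_ae`,
`map_withDensity_comp`).  No hypothesis on `a, θ` is used.
-/

noncomputable section

open MeasureTheory ProbabilityTheory Set Function Filter
open scoped ENNReal InnerProductSpace

namespace Summit.AtomisticToContinuum.HydrodynamicLimit.Theorems.LambertianContactSwapLambertianEulerGibbsInvariance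

open Literature.MathematicalPhysics.KineticTheory Literature.Analysis.FluidPDE

/-! ## Two measure-theoretic identities -/

/-- **Change of variables for densities**: `g_* (μ · (f ∘ g)) = (g_* μ) · f` for measurable
`g`, `f`. [folklore] -/
theorem map_withDensity_comp {α β : Type*} [MeasurableSpace α] [MeasurableSpace β]
    {μ : Measure α} {g : α → β} (hg : Measurable g) {f : β → ℝ≥0∞} (hf : Measurable f) :
    (μ.withDensity (f ∘ g)).map g = (μ.map g).withDensity f := by
  ext s hs
  rw [Measure.map_apply hg hs, withDensity_apply _ (hg hs), withDensity_apply _ hs,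
    setLIntegral_map hs hf hg]
  rfl

/-- **Transfer of invariance to an invariant density**: if a density `G` on the source agrees
`μ`-a.e. with `F ∘ g`, then `g_* (μ · G) = (g_* μ) · F`. [folklore] -/
theorem map_withDensity_of_ae_eq {α β : Type*} [MeasurableSpace α] [MeasurableSpace β]
    {μ : Measure α} {g : α → β} (hg : Measurable g) {F : β → ℝ≥0∞} (hF : Measurable F)
    {G : α → ℝ≥0∞} (hG : ∀ᵐ x ∂μ, G x = F (g x)) :
    (μ.withDensity G).map g = (μ.map g).withDensity F := by
  rw [withDensity_congr_ae (hG : G =ᵐ[μ] F ∘ g)]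
  exact map_withDensity_comp hg hF

/-! ## The canonical density with constant profiles is a function of `(1_D, E, P)` -/

/-- The canonical density with constant profiles takes the same value at two points of the
hard-sphere domain with the same kinetic energy and total momentum (closed form
`tensorPow_localGibbsProfile_const` + `sum_norm_vel_sub_sq_eq`). [folklore] -/
theorem canonicalDensity_const_eq {ε : ℝ} {n : ℕ} (a θ : ℝ) (u : V3)
    {z w : Config n (Fin 3) T3}
    (hz : z ∈ hardSphereDomain (Torus.geometry (Fin 3)) n ε)
    (hw : w ∈ hardSphereDomain (Torus.geometry (Fin 3)) n ε)
    (hE : configEnergy z = configEnergy w) (hP : configMomentum z = configMomentum w) :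
    canonicalDensity (Torus.geometry (Fin 3)) ε n
        (localGibbsProfile (fun _ => a) (fun _ => u) (fun _ => θ)) z =
      canonicalDensity (Torus.geometry (Fin 3)) ε n
        (localGibbsProfile (fun _ => a) (fun _ => u) (fun _ => θ)) w := by
  unfold canonicalDensity
  rw [indicator_of_mem hz, indicator_of_mem hw, tensorPow_localGibbsProfile_const,
    tensorPow_localGibbsProfile_const, sum_norm_vel_sub_sq_eq, sum_norm_vel_sub_sq_eq, hE, hP]

/-! ## Invariance of the canonical Gibbs laws along the Lambertian flow -/

/-- **`Λ`-invariance of `F · liouville` from `Λ`-invariance of `liouville ⊗ γ^ℕ`** (torus, any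
number `n` of spheres of diameter `ε < 1/2`, constant profiles, any time `t`): if
`(liouville ⊗ γ^ℕ) ∘ Λ_t⁻¹ = liouville` then
`((liouville · F) ⊗ γ^ℕ) ∘ Λ_t⁻¹ = liouville · F` for the canonical density `F` of the constant
local Gibbs profile. [folklore] -/
theorem map_prod_withDensity_canonical_eq {ε : ℝ} (hε' : ε < 2⁻¹) (n : ℕ) (a θ : ℝ) (u : V3)
    (t : ℝ)
    (hmap : ((liouville (Torus.geometry (Fin 3)) n ε).prod (lambertNoise (Fin 3))).map
        (fun p => lambertFlow (Torus.geometry (Fin 3)) ε p.2 p.1 t) =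
      liouville (Torus.geometry (Fin 3)) n ε) :
    (((liouville (Torus.geometry (Fin 3)) n ε).withDensity fun z => ENNReal.ofReal
        (canonicalDensity (Torus.geometry (Fin 3)) ε n
          (localGibbsProfile (fun _ => a) (fun _ => u) (fun _ => θ)) z)).prod
        (lambertNoise (Fin 3))).map
        (fun p => lambertFlow (Torus.geometry (Fin 3)) ε p.2 p.1 t) =
      (liouville (Torus.geometry (Fin 3)) n ε).withDensity fun z => ENNReal.ofReal
        (canonicalDensity (Torus.geometry (Fin 3)) ε n
          (localGibbsProfile (fun _ => a) (fun _ => u) (fun _ => θ)) z) := by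
  have hΛ : Measurable fun p : Config n (Fin 3) T3 × (ℕ → EuclideanSpace ℝ (Fin 3)) =>
      lambertFlow (Torus.geometry (Fin 3)) ε p.2 p.1 t :=
    measurable_lambertFlow_torus hε' t
  have hprof : Measurable (localGibbsProfile (fun _ : T3 => a) (fun _ => u) (fun _ => θ)) :=
    measurable_localGibbsProfile continuous_const continuous_const continuous_const
  have hF : Measurable fun z : Config n (Fin 3) T3 => ENNReal.ofReal
      (canonicalDensity (Torus.geometry (Fin 3)) ε n
        (localGibbsProfile (fun _ => a) (fun _ => u) (fun _ => θ)) z) :=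
    ENNReal.measurable_ofReal.comp (measurable_canonicalDensity _ _ hprof)
  have hEm : Measurable (configEnergy : Config n (Fin 3) T3 → ℝ) := by
    unfold configEnergy
    exact measurable_const.mul
      (Finset.measurable_sum _ fun i _ => ((measurable_pi_apply i).snd).norm.pow_const 2)
  have hD : MeasurableSet (hardSphereDomain (Torus.geometry (Fin 3)) n ε) :=
    measurableSet_hardSphereDomain _ Torus.measurable_geometry_sepVec _ _
  -- (A) almost every datum lies in the hard-sphere domain
  have hA : ∀ᵐ p ∂((liouville (Torus.geometry (Fin 3)) n ε).prod (lambertNoise (Fin 3))),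
      p.1 ∈ hardSphereDomain (Torus.geometry (Fin 3)) n ε :=
    Measure.quasiMeasurePreserving_fst.ae (ae_restrict_mem hD)
  -- (B) almost every image lies in the hard-sphere domain (from the invariance hypothesis)
  have hB : ∀ᵐ p ∂((liouville (Torus.geometry (Fin 3)) n ε).prod (lambertNoise (Fin 3))),
      lambertFlow (Torus.geometry (Fin 3)) ε p.2 p.1 t ∈
        hardSphereDomain (Torus.geometry (Fin 3)) n ε := by
    refine ae_of_ae_map hΛ.aemeasurable ?_
    rw [hmap]
    exact ae_restrict_mem hD
  -- (C) the kinetic energy is conserved almost surely (for every datum, a.e. noise; Fubini)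
  have hC : ∀ᵐ p ∂((liouville (Torus.geometry (Fin 3)) n ε).prod (lambertNoise (Fin 3))),
      configEnergy (lambertFlow (Torus.geometry (Fin 3)) ε p.2 p.1 t) = configEnergy p.1 := by
    refine (Measure.ae_prod_iff_ae_ae ?_).2 (ae_of_all _ fun z =>
      (ae_lambertNoise_forall_configEnergy_lambertFlow_torus hε' z).mono fun ξs h => h t)
    exact measurableSet_eq_fun (hEm.comp hΛ) (hEm.comp measurable_fst)
  -- (D) the momentum is conserved everywhere (`configMomentum_lambertFlow`)
  rw [prod_withDensity_left hF, map_withDensity_of_ae_eq hΛ hF ?_, hmap]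
  filter_upwards [hA, hB, hC] with p hpD hΛD hE
  rw [canonicalDensity_const_eq a θ u hpD hΛD hE.symm (configMomentum_lambertFlow p.2 p.1 t).symm]

/-- **`Λ`-invariance of the canonical hard-sphere Gibbs laws from Liouville ⊗ noise
invariance** (`LiouvilleInvarianceLambda → GibbsInvarianceLambda`): for constant profiles
`a, u, θ`, `0 < σ < 1/2`, every `N`, every flow `Φ` (type-fixing only) and `t ≥ 0`, the law of
`Λ_t(z, ξs)` under `localGibbsLaw ⊗ γ^ℕ` is `localGibbsLaw`, granted the invariance of
`liouville ⊗ γ^ℕ` under `Λ_t` at diameter `hsDiameter σ N < 1/2` and `N + 1` spheres. [folklore] -/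
theorem gibbsInvariance_of_liouvilleInvariance
    (hLI : ∀ ε : ℝ, 0 < ε → ε < 2⁻¹ → ∀ (N : ℕ) (t : ℝ), 0 ≤ t →
      ((liouville (Torus.geometry (Fin 3)) N ε).prod (lambertNoise (Fin 3))).map
          (fun p => lambertFlow (Torus.geometry (Fin 3)) ε p.2 p.1 t) =
        liouville (Torus.geometry (Fin 3)) N ε)
    {σ : ℝ} (hσ : 0 < σ) (hσ' : σ < 2⁻¹) (N : ℕ) (a θ : ℝ) (u : V3)
    (Φ : HardSphereFlow (Torus.geometry (Fin 3)) (hsDiameter σ N) (N + 1)) {t : ℝ} (ht : 0 ≤ t) :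
    ((localGibbsLaw σ (fun _ => a) (fun _ => u) (fun _ => θ) N Φ).prod (lambertNoise (Fin 3))).map
        (fun p => lambertFlow (Torus.geometry (Fin 3)) (hsDiameter σ N) p.2 p.1 t) =
      localGibbsLaw σ (fun _ => a) (fun _ => u) (fun _ => θ) N Φ := by
  have hε' : hsDiameter σ N < 2⁻¹ := (hsDiameter_le hσ.le N).trans_lt hσ'
  unfold localGibbsLaw
  rw [particleLaw_eq]
  exact map_prod_withDensity_canonical_eq hε' (N + 1) a θ u t
    (hLI (hsDiameter σ N) (hsDiameter_pos hσ N) hε' (N + 1) t ht)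

/-- Registered stub `stub_gibbsInvariance` of line `Sketch` (crux stmt-AtomisticToContinuum-11854):
`LiouvilleInvarianceLambda → GibbsInvarianceLambda` with the verbatim registered bodies, closed by
`gibbsInvariance_of_liouvilleInvariance`. [folklore] -/
theorem stub_gibbsInvariance :
    (∀ ε : ℝ, 0 < ε → ε < 2⁻¹ → ∀ (N : ℕ) (t : ℝ), 0 ≤ t →
      ((liouville (Torus.geometry (Fin 3)) N ε).prod (lambertNoise (Fin 3))).map
          (fun p => lambertFlow (Torus.geometry (Fin 3)) ε p.2 p.1 t) =
        liouville (Torus.geometry (Fin 3)) N ε) →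
    ∀ σ : ℝ, 0 < σ → σ < 2⁻¹ → ∀ (N : ℕ) (a θ : ℝ) (u : V3), 0 < a → 0 < θ →
    ∀ Φ : HardSphereFlow (Torus.geometry (Fin 3)) (hsDiameter σ N) (N + 1),
    ∀ t : ℝ, 0 ≤ t →
      ((localGibbsLaw σ (fun _ => a) (fun _ => u) (fun _ => θ) N Φ).prod (lambertNoise (Fin 3))).map
        (fun p => lambertFlow (Torus.geometry (Fin 3)) (hsDiameter σ N) p.2 p.1 t) =
      localGibbsLaw σ (fun _ => a) (fun _ => u) (fun _ => θ) N Φ :=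
  fun hLI _ hσ hσ' N a θ u _ _ Φ _ ht => gibbsInvariance_of_liouvilleInvariance hLI hσ hσ' N a θ u Φ ht

end Summit.AtomisticToContinuum.HydrodynamicLimit.Theorems.LambertianContactSwapLambertianEulerGibbsInvariance

end
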